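import Mathlib
import HarnessLib
import Summits.CriticalPhenomena.PercolationContinuityZ3.Theses.PercLowPointHalfSpace
import Summits.CriticalPhenomena.PercolationContinuityZ3.Theorems.QuantitativeBGN.Negative.LoadBearing
import Summits.CriticalPhenomena.PercolationContinuityZ3.Theorems.PercNonProliferationFreeBoxPowerSavingOneArmDictionary

/-!
# Crux `PercLowPointHalfSpace.QuantitativeBGN` (stmt-CriticalPhenomena-0913) — cone edges from the bulk

Helper file landed `--supports stmt-CriticalPhenomena-0913` (lead c6). The crux C asks for a RATE in
Barsky–Grimmett–Newman's `θ_H(p_c) = 0`: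
`∃ a > 0, C, ∀ r ≥ 1, P_{p_c(ℤ³)}(arm_H(0,r)) ≤ C r^{-a}`, where `arm_H(0,r)` = "the open cluster of `0`
in the half-space `H = {x₀ ≥ 0}` reaches sup-distance `≥ r`" (`QuantitativeBGN.Negative.armH r`).

This file records, kernel-checked, the trivial but so far untyped edges from BULK statements of the
sibling routes `PercNonProliferation` / `PercAnnulusCrossing` of the same sub-problem to C:

* `QuantitativeBGNConeEdges.real_armH_le_oneArmProb` — `P_p(arm_H(0,r)) ≤ π_p(r-1)` for `r ≥ 1`
  (first exit from `Λ_{r-1}`: an `H`-open path to sup-distance `r` is in particular an open path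
  leaving the box `Λ_{r-1}`; `π_p(m) = oneArmProb 3 p m = P_p(0 ↔ ∂ⁱⁿΛ_m in Λ_m)`).
* `QuantitativeBGNConeEdges.quantitativeBGNAt_of_oneArmRate` — at ANY `p`, a polynomial bulk
  one-arm rate `π_p(m) ≤ C m^{-s}` (`s > 0`, `m ≥ 1`) gives the crux's bound at `p` with `a = s`.
* `quantitativeBGN_of_oneArmRate` (registered sub-goal) — the same at `p = p_c(ℤ³)`: C by name.
* `quantitativeBGN_of_critAnnulusNonCrossing` (registered sub-goal) — **cone edge
  `X_B ⟹ C`**: `PercAnnulusCrossing.CritAnnulusNonCrossing` (item stmt-CriticalPhenomena-0846: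
  at `p_c` the annulus `Λ_{2n} ∖ Λ_n` is crossed with probability `≤ 1 - c`) implies C, through the
  landed dyadic-annulus dictionary `OneArmDictionary.oneArm_rate_of_critAnnulusNonCrossing`.
* `QuantitativeBGNConeEdges.quantitativeBGN_of_polynomialPair` — **cone edge
  `SubpolynomialBlocking ∧ FreeBoxPowerSaving ⟹ C`** (items of route `PercNonProliferation`,
  through `OneArmDictionary.oneArm_rate_of_polynomialPair`).

All three hypotheses are bulk RSW-class statements, STRONGER than C (C is the boundary rate only);
the edges are recorded so that the planners' cone bookkeeping sees them. The genuinely weaker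
same-`p` input of C (half-space Cesàro blocking) is the subject of a sibling file.

No new definitions; no sorry. Sources: G. Grimmett, *Percolation* (1999), §1.4, Thm. (7.35)
[GrimmettPercolation1999]; folklore (first exit, dyadic annuli).
-/

noncomputable section

namespace Summit.CriticalPhenomena.PercolationContinuityZ3.Theorems

namespace QuantitativeBGNConeEdges

open MeasureTheory Filter
open Literature.Probability.Percolation Literature.Probability.LatticeModels
open Summit.CriticalPhenomena.PercolationContinuityZ3.Theses.PercLowPointHalfSpace (QuantitativeBGN)
open Summit.CriticalPhenomena.PercolationContinuityZ3.Theorems.QuantitativeBGN.Negative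
  (armH QuantitativeBGNAt quantitativeBGN_iff mem_siteToBoundary_of_mem_armH)

/-- **First exit**: `P_p(arm_H(0,r)) ≤ π_p(r-1)` for `r ≥ 1` — an `H`-open path from `0` to
sup-distance `≥ r` leaves the box `Λ_{r-1}`, so `0 ↔ ∂ⁱⁿΛ_{r-1}` inside `Λ_{r-1}` (on lattice
configurations, which carry full measure). [folklore] -/
theorem real_armH_le_oneArmProb (p : unitInterval) {r : ℕ} (hr : 1 ≤ r) :
    (bondPercolation (zdGraph 3) p).real (armH r) ≤ oneArmProb 3 p (r - 1) := by
  unfold oneArmProb oneArm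
  refine DCT16.real_mono_of_forall_subset_edgeSet (zdGraph 3) p fun ω hω hA => ?_
  have hr' : r = (r - 1) + 1 := by omega
  rw [hr'] at hA
  exact mem_siteToBoundary_of_mem_armH hω hA

/-- **A bulk one-arm rate gives the crux's bound (at any `p`)**: if `π_p(m) ≤ C m^{-s}` for all
`m ≥ 1` with `s > 0`, then `P_p(arm_H(0,r)) ≤ (|C|·2^s + 1) r^{-s}` for all `r ≥ 1`.
(`r = 1`: probabilities are `≤ 1`; `r ≥ 2`: first exit and `(r-1)^{-s} ≤ 2^s r^{-s}`.) [folklore] -/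
theorem quantitativeBGNAt_of_oneArmRate (p : unitInterval)
    (h : ∃ s C : ℝ, 0 < s ∧ ∀ m : ℕ, 1 ≤ m → oneArmProb 3 p m ≤ C * (m : ℝ) ^ (-s)) :
    QuantitativeBGNAt p := by
  obtain ⟨s, C, hs, h⟩ := h
  refine ⟨s, |C| * (2 : ℝ) ^ s + 1, hs, fun r hr => ?_⟩
  have hrpos : (0 : ℝ) < r := by exact_mod_cast hr
  have hrs : 0 < (r : ℝ) ^ (-s) := Real.rpow_pos_of_pos hrpos _
  rcases Nat.lt_or_ge r 2 with hr2 | hr2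
  · -- `r = 1`
    have hr1 : r = 1 := by omega
    subst hr1
    simp only [Nat.cast_one, Real.one_rpow, mul_one]
    calc (bondPercolation (zdGraph 3) p).real (armH 1) ≤ 1 := measureReal_le_one
      _ ≤ |C| * (2 : ℝ) ^ s + 1 := by
        have : 0 ≤ |C| * (2 : ℝ) ^ s := by positivity
        linarith
  · -- `r ≥ 2`: first exit from `Λ_{r-1}`
    have hm : 1 ≤ r - 1 := by omega
    have h1 := real_armH_le_oneArmProb p hr
    have h2 := h (r - 1) hm
    have hcast : ((r - 1 : ℕ) : ℝ) = (r : ℝ) - 1 := by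
      rw [Nat.cast_sub hr, Nat.cast_one]
    rw [hcast] at h2
    -- `(r-1)^{-s} ≤ (r/2)^{-s} = 2^s r^{-s}` since `r/2 ≤ r - 1` for `r ≥ 2`
    have hr2' : (2 : ℝ) ≤ r := by exact_mod_cast hr2
    have hhalf : (r : ℝ) / 2 ≤ (r : ℝ) - 1 := by linarith
    have hhalfpos : 0 < (r : ℝ) / 2 := by positivity
    have hpow : ((r : ℝ) - 1) ^ (-s) ≤ ((r : ℝ) / 2) ^ (-s) :=
      Real.rpow_le_rpow_of_nonpos hhalfpos hhalf (by linarith)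
    have hsplit : ((r : ℝ) / 2) ^ (-s) = (2 : ℝ) ^ s * (r : ℝ) ^ (-s) := by
      rw [Real.div_rpow hrpos.le (by norm_num : (0 : ℝ) ≤ 2), Real.rpow_neg (by norm_num : (0 : ℝ) ≤ 2),
        inv_eq_one_div, div_div_eq_mul_div, Real.rpow_neg hrpos.le]
      field_simp
    calc (bondPercolation (zdGraph 3) p).real (armH r)
        ≤ oneArmProb 3 p (r - 1) := h1
      _ ≤ C * ((r : ℝ) - 1) ^ (-s) := h2
      _ ≤ |C| * ((r : ℝ) - 1) ^ (-s) :=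
          mul_le_mul_of_nonneg_right (le_abs_self C) (Real.rpow_nonneg (by linarith) _)
      _ ≤ |C| * ((2 : ℝ) ^ s * (r : ℝ) ^ (-s)) := by
          refine mul_le_mul_of_nonneg_left (hpow.trans_eq hsplit) (abs_nonneg C)
      _ = (|C| * (2 : ℝ) ^ s) * (r : ℝ) ^ (-s) := by ring
      _ ≤ (|C| * (2 : ℝ) ^ s + 1) * (r : ℝ) ^ (-s) := by
          exact mul_le_mul_of_nonneg_right (by linarith) hrs.le

end QuantitativeBGNConeEdges

open Literature.Probability.Percolation Literature.Probability.LatticeModels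
open Summit.CriticalPhenomena.PercolationContinuityZ3.Theorems.QuantitativeBGN.Negative (quantitativeBGN_iff)

/-- **A bulk one-arm rate at `p_c(ℤ³)` gives the crux `QuantitativeBGN`** (registered sub-goal; by
`QuantitativeBGNConeEdges.quantitativeBGNAt_of_oneArmRate` at `p = p_c`). [folklore] -/
theorem quantitativeBGN_of_oneArmRate : (∃ s C : ℝ, 0 < s ∧ ∀ m : ℕ, 1 ≤ m → Literature.Probability.Percolation.oneArmProb 3 (Literature.Probability.Percolation.criticalProbI 3) m ≤ C * (m : ℝ) ^ (-s)) → Summit.CriticalPhenomena.PercolationContinuityZ3.Theses.PercLowPointHalfSpace.QuantitativeBGN :=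
  fun h => quantitativeBGN_iff.2 (QuantitativeBGNConeEdges.quantitativeBGNAt_of_oneArmRate (criticalProbI 3) h)

/-- **Cone edge `X_B ⟹ C`** (registered sub-goal): the annulus non-crossing crux
`CritAnnulusNonCrossing` of route `PercAnnulusCrossing` (item stmt-CriticalPhenomena-0846) implies
`QuantitativeBGN`, through the landed dyadic-annulus argument
`OneArmDictionary.oneArm_rate_of_critAnnulusNonCrossing` (`X_B ⟹` polynomial bulk one-arm decay at
`p_c`) and `quantitativeBGN_of_oneArmRate`. [folklore] -/
theorem quantitativeBGN_of_critAnnulusNonCrossing : Summit.CriticalPhenomena.PercolationContinuityZ3.Theses.PercAnnulusCrossing.CritAnnulusNonCrossing → Summit.CriticalPhenomena.PercolationContinuityZ3.Theses.PercLowPointHalfSpace.QuantitativeBGN :=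
  fun hXB => quantitativeBGN_of_oneArmRate
    (Summit.CriticalPhenomena.PercolationContinuityZ3.FreeBoxPowerSavingLine.OneArmDictionary.oneArm_rate_of_critAnnulusNonCrossing
      hXB)

/-- **Cone edge `SubpolynomialBlocking ∧ FreeBoxPowerSaving ⟹ C`**: the polynomial pair of route
`PercNonProliferation` implies `QuantitativeBGN`, through the landed one-arm dictionary
`OneArmDictionary.oneArm_rate_of_polynomialPair`. [folklore] -/
theorem QuantitativeBGNConeEdges.quantitativeBGN_of_polynomialPair
    (h4 : Summit.CriticalPhenomena.PercolationContinuityZ3.Theses.PercNonProliferation.SubpolynomialBlocking)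
    (h5 : Summit.CriticalPhenomena.PercolationContinuityZ3.Theses.PercNonProliferation.FreeBoxPowerSaving) :
    Summit.CriticalPhenomena.PercolationContinuityZ3.Theses.PercLowPointHalfSpace.QuantitativeBGN :=
  quantitativeBGN_of_oneArmRate
    (Summit.CriticalPhenomena.PercolationContinuityZ3.FreeBoxPowerSavingLine.OneArmDictionary.oneArm_rate_of_polynomialPair
      h4 h5)



end Summit.CriticalPhenomena.PercolationContinuityZ3.Theorems

end
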